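import Summits.ValiantsHypothesis.ValiantsHypothesis.Theorems.LacunarySymmetroidMatrixDescartesCensusRootSide
import Summits.ValiantsHypothesis.ValiantsHypothesis.Theorems.LacunarySymmetroidMatrixDescartesCensusGramCross

/-!
# `MatrixDescartes` census — root-side `4 × 4`-MINOR CONSUMER («M4-POS(d) ⇒ no twenty on d», kernel schema)

HONEST FRAMING.  Object-search cell `pub-symmetroid`, route crux `Theses.LacunarySymmetroid.MatrixDescartes`
(ledger item stmt-ValiantsHypothesis-18050).  Companion of `…CensusRootSide.lean` (the root-side parametrization
schema of HYPOTHETICAL Descartes-sharp `2 × 2` pencil determinants): this file adds the one ingredient that needs the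
CROSS Gram-rank identity `Census.gram_det_cross_four_eq_zero` (`…CensusGramCross.lean`):

* `gramHat_minor_four_eq_zero_of_sidon` — on a 2-Sidon support every `4 × 4` minor (any four row letters, any four
  column letters) of the would-be Gram matrix `Ĝ_ij = (2 if i = j else 1) · coeff (det F) (d i + d j)` of a real
  symmetric `2 × 2` pencil vanishes (`Ĝ = 2·Gram_B(S)`, `gramHat_entry_of_sidon`, and `B` has rank `≤ 3`);
* `card_posRoots_le_19_of_minor_four_ne_zero` — **the M4 consumer** for six-term supports: if one `4 × 4` minor of
  the ROOT-SIDE matrix `Ĝ(c(ρ))` never vanishes on sorted positive `ρ : Fin 20 → ℝ` (engine-5 g14's «M4-POS(d)»,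
  E5G14-RANK3 §4b, lead R1131: `d = (0,2,3,7,15,26)`, rows `(0,1,2,4)`, columns `(0,2,3,4)`, typed NEVER ASSERTED as
  `M4Pos_0_2_3_7_15_26` in `…CensusRootSideDefs.lean`), then every real symmetric `2 × 2` pencil on `d` has at most
  `19` distinct positive determinant roots — by `card_posRoots_le_19_of_rootSide` with `Φ =` that minor (pencil
  side it vanishes; root side the coefficients of a twenty are `t · c(ρ)`, `t ≠ 0`, and the minor scales by `t⁴`);
* `card_posRoots_le_19_of_exists_minor_four_ne_zero` — the same with the non-zero minor CHOSEN DEPENDING ON `ρ`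
  («`rank Ĝ(c(ρ)) ≥ 4` at every sorted positive `ρ` ⇒ no twenty on `d`»; `Φ =` sum of squares of all `4 × 4` minors),
  the form that region-by-region («paired-minor») root-side certificates consume.

Nothing here is specific to one support, asserts `M4-POS`, or bears on `DoorA26` (OPEN, never asserted) as a
format-level statement, on the crux `MatrixDescartes`, or on `VP ≠ VNP`.  [folklore] Linear algebra.
-/

-- `Summit.ValiantsHypothesis.ValiantsHypothesis.…` repeats a component by the D-0017 layout
-- (single-conjunct summit), which the `dupNamespace` linter flags; the name is mandated.
set_option linter.dupNamespace false

namespace Summit.ValiantsHypothesis.ValiantsHypothesis.Theorems.LacunarySymmetroidMatrixDescartes.Census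

open Polynomial Finset
open scoped BigOperators Polynomial Matrix

/-- Every `4 × 4` minor of the would-be Gram matrix `Ĝ` of a real symmetric `2 × 2` pencil on a 2-Sidon support
vanishes (rank `≤ 3`: `gram_det_cross_four_eq_zero`), for any choice of four row letters `R` and four column
letters `Cc`. [folklore] -/
theorem gramHat_minor_four_eq_zero_of_sidon {K : ℕ} (d : Fin K → ℕ)
    (hSidon : ∀ p q : Fin K × Fin K, d p.1 + d p.2 = d q.1 + d q.2 → p = q ∨ p = q.swap)
    (S : Fin K → Matrix (Fin 2) (Fin 2) ℝ) (hS : ∀ l, (S l).IsSymm) (R Cc : Fin 4 → Fin K) :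
    (Matrix.of fun a b : Fin 4 => (if R a = Cc b then (2 : ℝ) else 1) *
      (∑ l, ((X : ℝ[X]) ^ d l) • (S l).map C).det.coeff (d (R a) + d (Cc b))).det = 0 := by
  have h := gram_det_cross_four_eq_zero (fun a => S (R a)) (fun b => S (Cc b))
  convert h using 2
  ext a b
  simp only [Matrix.of_apply]
  exact gramHat_entry_of_sidon d hSidon S hS (R a) (Cc b)

/-- **The `4 × 4`-minor consumer («M4-POS(d) ⇒ no twenty on d»).**  Let `d : Fin 6 → ℕ` be 2-Sidon with its 21
pair sums enumerated increasingly by `E` through an index table `uOf` (`E (uOf i j) = d i + d j`; decidable data),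
and fix four row letters `R` and four column letters `Cc`.  If the corresponding `4 × 4` minor of the ROOT-SIDE
would-be Gram matrix `Ĝ(c(ρ))`, `Ĝ_ij = (2 if i = j else 1) · c_{uOf i j}(ρ)`, is non-zero for every sorted
positive `ρ : Fin 20 → ℝ` (engine-5's «M4-POS(d)» is the case `d = (0,2,3,7,15,26)`, `R = (0,1,2,4)`,
`Cc = (0,2,3,4)`, with `> 0`), then every real symmetric `2 × 2` pencil on `d` has at most 19 distinct positive
determinant roots.  (Pencil side: that minor of `Ĝ(coefficients)` vanishes, `gramHat_minor_four_eq_zero_of_sidon`;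
root side: the coefficients of a twenty are `t · c(ρ)`, `t ≠ 0`, and the minor scales by `t⁴`.) [folklore] -/
theorem card_posRoots_le_19_of_minor_four_ne_zero (d : Fin 6 → ℕ)
    (hSidon : ∀ p q : Fin 6 × Fin 6, d p.1 + d p.2 = d q.1 + d q.2 → p = q ∨ p = q.swap)
    (E : Fin 21 → ℕ) (hE : StrictMono E) (uOf : Fin 6 → Fin 6 → Fin 21)
    (huOf : ∀ i j, E (uOf i j) = d i + d j) (R Cc : Fin 4 → Fin 6)
    (hpos : ∀ ρ : Fin 20 → ℝ, (∀ i, 0 < ρ i) → StrictMono ρ →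
      (Matrix.of fun a b : Fin 4 => (if R a = Cc b then (2 : ℝ) else 1) *
        ((-1 : ℝ) ^ (uOf (R a) (Cc b) : ℕ) *
          (Matrix.of fun i v => ρ i ^ E ((uOf (R a) (Cc b)).succAbove v)).det)).det ≠ 0)
    (S : Fin 6 → Matrix (Fin 2) (Fin 2) ℝ) (hS : ∀ l, (S l).IsSymm) :
    ((∑ l, ((X : ℝ[X]) ^ d l) • (S l).map C).det.roots.toFinset.filter (fun t => 0 < t)).card ≤ 19 := by
  have hWE : ∀ p : Fin 6 × Fin 6, d p.1 + d p.2 ∈ Finset.univ.image E :=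
    fun p => Finset.mem_image.mpr ⟨uOf p.1 p.2, Finset.mem_univ _, huOf p.1 p.2⟩
  refine card_posRoots_le_19_of_rootSide d E hE hWE
    (fun c => (Matrix.of fun a b : Fin 4 => (if R a = Cc b then (2 : ℝ) else 1) * c (uOf (R a) (Cc b))).det)
    (fun S' hS' => ?_) (fun ρ hρ0 hρ t ht => ?_) S hS
  · -- pencil side: rewrite `coeff (E (uOf i j))` as `coeff (d i + d j)` and use the Gram rank identity
    have h := gramHat_minor_four_eq_zero_of_sidon d hSidon S' hS' R Cc
    simp only [huOf]
    exact h
  · -- root side: the minor of `t • Ĝ(c(ρ))` is `t ^ 4` times the minor of `Ĝ(c(ρ))`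
    have h := hpos ρ hρ0 hρ
    have hscale : (Matrix.of fun a b : Fin 4 => (if R a = Cc b then (2 : ℝ) else 1) *
        (t * ((-1 : ℝ) ^ (uOf (R a) (Cc b) : ℕ) *
          (Matrix.of fun i v => ρ i ^ E ((uOf (R a) (Cc b)).succAbove v)).det))) =
        t • (Matrix.of fun a b : Fin 4 => (if R a = Cc b then (2 : ℝ) else 1) *
          ((-1 : ℝ) ^ (uOf (R a) (Cc b) : ℕ) *
            (Matrix.of fun i v => ρ i ^ E ((uOf (R a) (Cc b)).succAbove v)).det)) := by
      ext a b
      simp only [Matrix.of_apply, Matrix.smul_apply, smul_eq_mul]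
      ring
    rw [hscale, Matrix.det_smul, Fintype.card_fin]
    exact mul_ne_zero (pow_ne_zero _ ht) h

/-- **The `4 × 4`-minor consumer, ρ-DEPENDENT form («rank `Ĝ(c(ρ)) ≥ 4` everywhere ⇒ no twenty on d»).**  Same data
as `card_posRoots_le_19_of_minor_four_ne_zero`, but the non-vanishing `4 × 4` minor of the root-side would-be Gram
matrix `Ĝ(c(ρ))` may now be CHOSEN DEPENDING ON `ρ` (four row letters `R`, four column letters `Cc`, any for each
sorted positive `ρ`): if at every sorted positive `ρ : Fin 20 → ℝ` SOME `4 × 4` minor of `Ĝ(c(ρ))` is non-zero —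
i.e. `Ĝ(c(ρ))` has rank `≥ 4` everywhere on the root side — then every real symmetric `2 × 2` pencil on the 2-Sidon
support `d` has at most `19` distinct positive determinant roots.  (Schema `card_posRoots_le_19_of_rootSide` with
`Φ =` the sum of the squares of ALL `4 × 4` minors: `0` on pencils by `gramHat_minor_four_eq_zero_of_sidon`,
positive on `t · c(ρ)`.)  This is the form «paired-minor» / region-by-region root-side certificates consume.
[folklore] -/
theorem card_posRoots_le_19_of_exists_minor_four_ne_zero (d : Fin 6 → ℕ)
    (hSidon : ∀ p q : Fin 6 × Fin 6, d p.1 + d p.2 = d q.1 + d q.2 → p = q ∨ p = q.swap)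
    (E : Fin 21 → ℕ) (hE : StrictMono E) (uOf : Fin 6 → Fin 6 → Fin 21)
    (huOf : ∀ i j, E (uOf i j) = d i + d j)
    (hpos : ∀ ρ : Fin 20 → ℝ, (∀ i, 0 < ρ i) → StrictMono ρ → ∃ R Cc : Fin 4 → Fin 6,
      (Matrix.of fun a b : Fin 4 => (if R a = Cc b then (2 : ℝ) else 1) *
        ((-1 : ℝ) ^ (uOf (R a) (Cc b) : ℕ) *
          (Matrix.of fun i v => ρ i ^ E ((uOf (R a) (Cc b)).succAbove v)).det)).det ≠ 0)
    (S : Fin 6 → Matrix (Fin 2) (Fin 2) ℝ) (hS : ∀ l, (S l).IsSymm) :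
    ((∑ l, ((X : ℝ[X]) ^ d l) • (S l).map C).det.roots.toFinset.filter (fun t => 0 < t)).card ≤ 19 := by
  have hWE : ∀ p : Fin 6 × Fin 6, d p.1 + d p.2 ∈ Finset.univ.image E :=
    fun p => Finset.mem_image.mpr ⟨uOf p.1 p.2, Finset.mem_univ _, huOf p.1 p.2⟩
  refine card_posRoots_le_19_of_rootSide d E hE hWE
    (fun c => ∑ R : Fin 4 → Fin 6, ∑ Cc : Fin 4 → Fin 6,
      (Matrix.of fun a b : Fin 4 => (if R a = Cc b then (2 : ℝ) else 1) * c (uOf (R a) (Cc b))).det ^ 2)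
    (fun S' hS' => ?_) (fun ρ hρ0 hρ t ht => ?_) S hS
  · -- pencil side: every `4 × 4` minor of `Ĝ(coefficients)` vanishes
    refine Finset.sum_eq_zero fun R _ => Finset.sum_eq_zero fun Cc _ => ?_
    have h := gramHat_minor_four_eq_zero_of_sidon d hSidon S' hS' R Cc
    simp only [huOf]
    rw [h]
    norm_num
  · -- root side: the chosen minor of `t • Ĝ(c(ρ))` is `t ^ 4 · (minor of Ĝ(c(ρ))) ≠ 0`, so the sum of squares is `> 0`
    obtain ⟨R, Cc, hne⟩ := hpos ρ hρ0 hρ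
    intro hsum
    have h1 := (Finset.sum_eq_zero_iff_of_nonneg fun R' _ =>
      Finset.sum_nonneg fun Cc' _ => sq_nonneg
        ((Matrix.of fun a b : Fin 4 => (if R' a = Cc' b then (2 : ℝ) else 1) *
          (t * ((-1 : ℝ) ^ (uOf (R' a) (Cc' b) : ℕ) *
            (Matrix.of fun i v => ρ i ^ E ((uOf (R' a) (Cc' b)).succAbove v)).det))).det)).mp
      hsum R (Finset.mem_univ _)
    have h2 := (Finset.sum_eq_zero_iff_of_nonneg fun Cc' _ => sq_nonneg
        ((Matrix.of fun a b : Fin 4 => (if R a = Cc' b then (2 : ℝ) else 1) *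
          (t * ((-1 : ℝ) ^ (uOf (R a) (Cc' b) : ℕ) *
            (Matrix.of fun i v => ρ i ^ E ((uOf (R a) (Cc' b)).succAbove v)).det))).det)).mp
      h1 Cc (Finset.mem_univ _)
    have hscale : (Matrix.of fun a b : Fin 4 => (if R a = Cc b then (2 : ℝ) else 1) *
        (t * ((-1 : ℝ) ^ (uOf (R a) (Cc b) : ℕ) *
          (Matrix.of fun i v => ρ i ^ E ((uOf (R a) (Cc b)).succAbove v)).det))) =
        t • (Matrix.of fun a b : Fin 4 => (if R a = Cc b then (2 : ℝ) else 1) *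
          ((-1 : ℝ) ^ (uOf (R a) (Cc b) : ℕ) *
            (Matrix.of fun i v => ρ i ^ E ((uOf (R a) (Cc b)).succAbove v)).det)) := by
      ext a b
      simp only [Matrix.of_apply, Matrix.smul_apply, smul_eq_mul]
      ring
    rw [hscale, Matrix.det_smul, Fintype.card_fin] at h2
    exact pow_ne_zero 2 (mul_ne_zero (pow_ne_zero _ ht) hne) h2

end Summit.ValiantsHypothesis.ValiantsHypothesis.Theorems.LacunarySymmetroidMatrixDescartes.Census
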